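import Summits.Ventures.PercRepro.Night2GoodTwoNoD2
import Summits.Ventures.PercRepro.Night2GoodTwoD2Lines

/-!
# night-2: the pairs of the load sum, and the pairs that load a distance-2 target

The load `dload M 5 G (bigP M G) dsh S` is a double sum over the thin big members `B` and the points `z ∈ G ∖ clF B`;
`loadPairs` collects the pairs `(B, z)` in one finset, so that the load is a single sum (`dload_eq_sum_loadPairs`).
At a distance-2 target `S` of a covered lossy big pair, the `dshGT` load vanishes (`dload_gt_eq_zero_of_mem_d2Targets`),
so every pair with a nonzero `dshGT2` term at `S` is itself a covered lossy big pair whose distance-2 targets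
contain `S` (`d2_of_dshGT2_ne_zero`, paper NIGHT-2-g30 §7.6 (a)).
-/

namespace PercRepro.Shadow

open PercRepro.ThmH PercRepro.PerFlat

variable {α : Type*} [DecidableEq α] {M : Matroid α} [M.Finite] {G : Finset α}

/-- The pairs `(B, z)` of the load sum, as one finset. -/
noncomputable def loadPairs (M : Matroid α) [M.Finite] (G : Finset α) : Finset (Σ _ : Finset α, α) :=
  ((thinMembers M 5 G).filter (bigP M G)).sigma (fun B => G \ clF M B)

/-- Membership in `loadPairs`. -/
theorem mem_loadPairs {p : Σ _ : Finset α, α} :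
    p ∈ loadPairs M G ↔ (p.1 ∈ thinMembers M 5 G ∧ 5 ≤ (p.1 \ coloops M G).card) ∧ p.2 ∈ G \ clF M p.1 := by
  unfold loadPairs
  rw [Finset.mem_sigma, Finset.mem_filter]

/-- The load is the sum over `loadPairs`. -/
theorem dload_eq_sum_loadPairs (dsh : Finset α → α → Finset α → ℚ) (S : Finset α) :
    dload M 5 G (bigP M G) dsh S = ∑ p ∈ loadPairs M G, dsh p.1 p.2 S := by
  unfold dload loadPairs
  rw [Finset.sum_sigma]

/-- Termwise `dshGT2 ≤ dshGT` off the distance-2 pairs, with the lossless case included. -/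
theorem dshGT2_le_dshGT_of_not_d2' (hG : G ∈ flatsQ M (5 + 1)) (hd : (gr M \ G).card ≤ 5)
    {B : Finset α} {z : α} {S : Finset α}
    (h : (gtPts M 5 G (insert z B)).Nonempty ∨ S ∉ d2Targets M 5 G (insert z B) ∨ loss M 5 G B z = 0) :
    dshGT2 M 5 G B z S ≤ dshGT M 5 G B z S := by
  rcases h with h | h | h
  · exact dshGT2_le_dshGT_of_not_d2 hG hd (Or.inl h)
  · exact dshGT2_le_dshGT_of_not_d2 hG hd (Or.inr h)
  · rw [dshGT2_eq_zero_of_loss_eq_zero h, dshGT_eq_zero_of_loss_eq_zero h]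

/-- **Every pair with a nonzero `dshGT2` term at a distance-2 target of a covered lossy big pair is itself a covered
lossy big pair loading the target at distance two.** -/
theorem d2_of_dshGT2_ne_zero (hG : G ∈ flatsQ M (5 + 1)) (hd : (gr M \ G).card = 2)
    (hk : kColoops M G = 1) (hs : ∀ e ∈ gr M, ∀ f ∈ gr M, e ≠ f → rkN M {e, f} = 2)
    (hl : ∀ e ∈ gr M, M.Indep {e}) {B : Finset α} (hB : B ∈ thinMembers M 5 G)
    (hbig : 5 ≤ (B \ coloops M G).card) {z : α} (hz : z ∈ G \ clF M B) (h : loss M 5 G B z ≠ 0)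
    (hno : ¬ (gtPts M 5 G (insert z B)).Nonempty) {S : Finset α} (hS : S ∈ d2Targets M 5 G (insert z B))
    {B' : Finset α} (hB' : B' ∈ thinMembers M 5 G) {z' : α} (hz' : z' ∈ G \ clF M B')
    (hne : dshGT2 M 5 G B' z' S ≠ 0) :
    loss M 5 G B' z' ≠ 0 ∧ ¬ (gtPts M 5 G (insert z' B')).Nonempty ∧ S ∈ d2Targets M 5 G (insert z' B') := by
  have hd' : (gr M \ G).card ≤ 5 := by omega
  have hloss' : loss M 5 G B' z' ≠ 0 := fun h0 => hne (dshGT2_eq_zero_of_loss_eq_zero h0 S)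
  have hgt : dshGT M 5 G B' z' S = 0 :=
    dshGT_eq_zero_of_mem_d2Targets hG hd hk hs hl hB hbig hz h hno hS hB' hz'
  refine ⟨hloss', ?_⟩
  by_contra hnot
  apply hne
  have hle := dshGT2_le_dshGT_of_not_d2 hG hd' (B := B') (z := z') (S := S) (by
    by_cases h1 : (gtPts M 5 G (insert z' B')).Nonempty
    · exact Or.inl h1
    · right
      intro h2
      exact hnot ⟨h1, h2⟩)
  rw [hgt] at hle
  exact le_antisymm hle (dshGT2_nonneg hG hd' B' z' S)

end PercRepro.Shadow
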